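/-
Copyright (c) 2026. All rights reserved.
Released under Apache 2.0 license as described in the file LICENSE.
Authors: abc-iut cell, cone prover seat abc-iut-w6-d036 (block C / W6, gen 6).
-/
import Literature.AnabelianGeometry.AbsoluteAnabelian.LogShellsArchProofs
import Literature.AnabelianGeometry.AbsoluteAnabelian.LogFrobeniusGraphs
import Literature.AnabelianGeometry.AbsoluteAnabelian.MonoAnalyticArchSegProofs
import Mathlib.Analysis.Calculus.FDeriv.RestrictScalars
import Mathlib.Analysis.SpecialFunctions.ExpDeriv
import Mathlib.Topology.Instances.RealVectorSpace
import HarnessLib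

/-!
# [AbsTopIII] Definition 5.4 (v): the archimedean log-Frobenius graph and its log-shell — remaining printed clauses

S. Mochizuki, *Topics in absolute anabelian geometry III: global reconstruction algorithms*,
J. Math. Sci. Univ. Tokyo 22 (2015) 939–1156 [MochizukiAbsTopIII2015]; locators `p.N l.M` = page and line of
the author's manuscript (lit key `paper:url-5493eb38cbb7`, 164 pp.), read on this seat's own render: Def 5.4 (v)
= p. 127 l. 66 – p. 128 l. 12; Def 4.1 (i) p. 101 l. 7–20 (`k~ ↠ k^× := k ∖ {0}` the universal covering, `log_k`),
Def 4.1 (i) p. 101 l. 49 – p. 102 l. 5 (the categories `TH`, `TH⊞`), Def 4.1 (iv) p. 104 last lines – p. 105 l. 2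
(the pre-log-shell `𝒪^×_k ⊆ k^×` "in the natural quotient `k~ ↠ k^×`").

PROOF-ONLY companion (no new definitions) of the typed node `AbsTopIII:Def5.4(v)`: statement files
`LogFrobeniusGraphs.lean` (p404505, the quiver `ArchVertex`/`ArchEdge` with `InLeft`/`InRight`/`InCore`) and
`LogShells.lean` §D (p403899, the model `k~ ≅ ℂ`: `ComplexLogShell.preLogShell = ℐ*`, `logShell = ℐ`,
`units = 𝒪^×_{k~}`), and of the companion `LogShellsArchProofs.lean` (p428168: uniqueness of `ℐ*`, the display
`𝒪_{k~} = π⁻¹·ℐ ⊆ ℐ = 𝒪^×_{k~}·ℐ*`, bijectivity onto the pre-log-shell except at the endpoints, `ℐ` = closure of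
`⋃_ζ ζ·ℐ*`). Read against print sentence by sentence, the following Prop-valued printed clauses of Def 5.4 (v)
were not yet kernel theorems; this file proves them, in the same model and over the same frozen quiver:

* p. 127 l. 71–83, "write `Γ⃗^⋉_arc` (respectively, `Γ⃗^⋊_arc`) for the oriented subgraph … obtained by removing the
  arrow `↪ k` on the right (respectively, the arrow `k~ →(id)` on the left) and `Γ⃗^×_arc` for the intersection":
  `ArchEdge.not_inLeft_iff`, `ArchEdge.not_inRight_iff` (the removed arrow is EXACTLY the named one),
  `ArchEdge.not_inLeft_iff_isSpaceLink` / `ArchEdge.not_inRight_iff_isPostLog` (it is the arrow into the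
  space-link vertex / out of the post-log vertex), `ArchEdge.inLeft_or_inRight`, `ArchEdge.eq_of_inCore`;
  p. 127 l. 83–89 (vertex names): `ArchVertex.isPreLog_of_isSpaceLink`, `ArchVertex.existsUnique_isSpaceLink`,
  `ArchVertex.not_isSpaceLink_postLog`, `ArchEdge.isPreLog_of_isShellArrow`.
* p. 127 l. 66–70 with Def 4.1 (i), "the commutative diagram of natural maps `k~ →(id) k~ →(shell) k^× ↪ k`":
  in the model the shell-arrow is `Complex.exp`, whose image is exactly `k^× = k ∖ {0}`
  (`ComplexLogShell.range_shellArrow`), a continuous homomorphism `(k~, +) → (k^×, ·)` that is holomorphic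
  (`ComplexLogShell.shellArrow_continuous_hom_holomorphic`); the pre-log-shell of Def 4.1 (iv) is the image of
  `ℐ*`, equal to the typed `𝒪^×_{k~}`, a compact subset of `k^×` (`ComplexLogShell.exp_image_preLogShell_eq_units`).
* p. 127 l. 92–97, "the entire diagram `Γ⃗^log_arc` may be considered as a diagram in the category `TH`, whereas
  the diagram `Γ⃗^⋉_arc` may be considered either as a diagram in `TH` or as a diagram in `TH⊞` [i.e., relative to
  the additive topological group structure of the field `k~`]": the two arrows of `Γ⃗^⋉_arc` are continuous group
  homomorphisms that are holomorphic (`ComplexLogShell.leftGraph_arrows_hom_holomorphic`), the removed space-link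
  arrow `k^× ↪ k` is holomorphic on the open `k^×` (`ComplexLogShell.spaceLinkArrow_holomorphicOn`) but does NOT
  carry the multiplication of `k^×` to the addition of `k` (`ComplexLogShell.spaceLinkArrow_not_hom`).
* p. 128 l. 2–4, "`ℐ*` … the uniquely determined line segment [i.e., more precisely: closure of a connected
  pre-compact open subset of a one-parameter subgroup] of `k~`": the typed `ℐ*` IS the closure of the open
  segment `(-π, π)·i` (`ComplexLogShell.preLogShell_eq_closure_image_Ioo`), that segment is the image under the
  one-parameter subgroup `t ↦ t·i` (`ComplexLogShell.oneParameterSubgroup_I`: continuous, injective, additive) of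
  an open connected subset of `ℝ` with compact closure and is open in the subgroup for the relative topology and
  pre-compact in `k~` (`ComplexLogShell.openSegment_isOpen_isConnected_precompact`); `ℐ*` and `ℐ` are compact
  (`ComplexLogShell.isCompact_preLogShell`, `ComplexLogShell.isCompact_logShell`); and UNIQUENESS in exactly this
  topological formulation (`ComplexLogShell.eq_preLogShell_of_closure_image`, reducing to p428168's
  `eq_preLogShell_of_neg_mem_of_endpoints` via p430172's `eq_Ioo_of_isOpen_of_isConnected`).
* p. 128 l. 9–12, "`ℐ` may be constructed as the closure of the union of the images of `ℐ*` via the finite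
  order automorphisms of the Aut-holomorphic group `k~`; in particular, the formation of `ℐ` from `ℐ*` depends
  only on the structure of `k~` as an object of `TH⊞`": p428168 proved this with the automorphisms READ as
  `z ↦ ζ·z`, `ζ` a root of unity; here that reading is itself proved — every holomorphic additive self-map of
  `k~ ≅ ℂ` is `z ↦ f(1)·z` (`ComplexLogShell.addMonoidHom_eq_mul_of_differentiable`, via the `ℝ`-linearity of
  continuous additive maps and uniqueness of the Fréchet derivative), the finite-order ones have `f(1)` a root of
  unity (`ComplexLogShell.pow_apply_one_eq_one_of_iterate_eq_id`) and are bijective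
  (`ComplexLogShell.bijective_of_iterate_eq_id`), so the clause holds with the union indexed by ALL finite-order
  automorphisms of the additive holomorphic group `k~` — i.e. by `TH⊞`-structure only
  (`ComplexLogShell.closure_iUnion_finiteOrderAut_image_preLogShell`).

Cone node `AbsTopIII:Def5.4(v)` of the cell's DAG. Refereed pre-IUT anabelian geometry (elementary complex
analysis and bookkeeping on a four-vertex quiver); nothing here bears on the disputed [IUTchIII] Cor. 3.12;
typed ≠ discharged; model-level (the model `k~ ≅ ℂ` of `LogShells.lean`).
-/

set_option autoImplicit false

noncomputable section

open Set Metric Complex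
open scoped Pointwise Real

namespace Literature.AnabelianGeometry.AbsoluteAnabelian

/-! ## §1 Def 5.4 (v), the oriented graph `Γ⃗^log_arc`: which arrow each sub-graph removes, which vertex is which -/

namespace ArchVertex

/-- "the other vertices of `Γ⃗^log_arc` [are] pre-log vertices; also we shall refer to the vertex … `k` as the
space-link vertex": the space-link vertex is one of the pre-log vertices.
[cite: MochizukiAbsTopIII2015, Def 5.4 (v) p. 127] -/
theorem isPreLog_of_isSpaceLink {ν : ArchVertex} (h : ν.IsSpaceLink) : ν.IsPreLog := by
  unfold IsSpaceLink at h
  subst h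
  decide

/-- `Γ⃗^log_arc` has exactly one space-link vertex ("the vertex … given by `k`").
[cite: MochizukiAbsTopIII2015, Def 5.4 (v) p. 127] -/
theorem existsUnique_isSpaceLink : ∃! ν : ArchVertex, ν.IsSpaceLink := ⟨spaceLink, rfl, fun _ h => h⟩

/-- the post-log vertex (the first `k~`) is not the space-link vertex `k`.
[cite: MochizukiAbsTopIII2015, Def 5.4 (v) p. 127] -/
theorem not_isSpaceLink_postLog : ¬ postLog.IsSpaceLink := fun h => ArchVertex.noConfusion h

end ArchVertex

namespace ArchEdge

/-- `Γ⃗^⋉_arc` is "obtained by removing the arrow `↪ k` on the right": the arrow of `Γ⃗^log_arc` missing from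
`Γ⃗^⋉_arc` is EXACTLY `k^× ↪ k`. [cite: MochizukiAbsTopIII2015, Def 5.4 (v) p. 127] -/
theorem not_inLeft_iff {a b : ArchVertex} (e : ArchEdge a b) : ¬ e.InLeft ↔ (a = .mult ∧ b = .spaceLink) := by
  cases e <;> simp [InLeft]

/-- `Γ⃗^⋊_arc` is "obtained by removing … the arrow `k~ →(id)` on the left": the arrow of `Γ⃗^log_arc` missing from
`Γ⃗^⋊_arc` is EXACTLY the post-log arrow `k~ →(id) k~`. [cite: MochizukiAbsTopIII2015, Def 5.4 (v) p. 127] -/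
theorem not_inRight_iff {a b : ArchVertex} (e : ArchEdge a b) : ¬ e.InRight ↔ (a = .postLog ∧ b = .pre) := by
  cases e <;> simp [InRight]

/-- the arrow removed "on the right" is the one arrow ENDING at the space-link vertex `k`.
[cite: MochizukiAbsTopIII2015, Def 5.4 (v) p. 127] -/
theorem not_inLeft_iff_isSpaceLink {a b : ArchVertex} (e : ArchEdge a b) : ¬ e.InLeft ↔ b.IsSpaceLink := by
  cases e <;> simp [InLeft, ArchVertex.IsSpaceLink]

/-- the arrow removed "on the left" is the one arrow STARTING at the post-log vertex.
[cite: MochizukiAbsTopIII2015, Def 5.4 (v) p. 127] -/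
theorem not_inRight_iff_isPostLog {a b : ArchVertex} (e : ArchEdge a b) : ¬ e.InRight ↔ a.IsPostLog := by
  cases e <;> simp [InRight, ArchVertex.IsPostLog]

/-- the two removals concern different arrows: every arrow of `Γ⃗^log_arc` lies in `Γ⃗^⋉_arc` or in `Γ⃗^⋊_arc`.
[cite: MochizukiAbsTopIII2015, Def 5.4 (v) p. 127] -/
theorem inLeft_or_inRight {a b : ArchVertex} (e : ArchEdge a b) : e.InLeft ∨ e.InRight := by
  cases e <;> simp [InLeft, InRight]

/-- the post-log arrow lies in `Γ⃗^⋉_arc` but not in `Γ⃗^⋊_arc`; the space-link arrow `k^× ↪ k` lies in `Γ⃗^⋊_arc`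
but not in `Γ⃗^⋉_arc`. [cite: MochizukiAbsTopIII2015, Def 5.4 (v) p. 127] -/
theorem inLeft_postLogId_inRight_multToSpaceLink :
    (postLogId.InLeft ∧ ¬ postLogId.InRight) ∧ (multToSpaceLink.InRight ∧ ¬ multToSpaceLink.InLeft) :=
  ⟨⟨trivial, fun h => h⟩, ⟨trivial, fun h => h⟩⟩

/-- "`Γ⃗^×_arc` for the intersection": an arrow of `Γ⃗^×_arc` joins the pre-log `k~` (the typed `shellInitial`, the
vertex carrying the shell-containers of Cor 5.10) to `k^×`. [cite: MochizukiAbsTopIII2015, Def 5.4 (v) p. 127] -/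
theorem eq_of_inCore {a b : ArchVertex} (e : ArchEdge a b) (h : e.InCore) :
    a = ArchVertex.shellInitial ∧ b = .mult := by
  cases e with
  | postLogId => exact absurd h.2 (fun x => x)
  | shell => exact ⟨rfl, rfl⟩
  | multToSpaceLink => exact absurd h.1 (fun x => x)

/-- the shell-arrow `k~ ↠ k^×` joins two PRE-log vertices, neither of which is the space-link vertex.
[cite: MochizukiAbsTopIII2015, Def 5.4 (v) p. 128] -/
theorem isPreLog_of_isShellArrow {a b : ArchVertex} (e : ArchEdge a b) (h : e.IsShellArrow) :
    a.IsPreLog ∧ b.IsPreLog ∧ ¬ a.IsSpaceLink ∧ ¬ b.IsSpaceLink := by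
  cases e <;> simp_all [IsShellArrow, ArchVertex.IsPreLog, ArchVertex.IsSpaceLink]

end ArchEdge

/-! ## §2 The natural maps of the diagram, in the model `k~ ≅ ℂ` of `LogShells.lean` §D

In the model the post-log and pre-log copies of `k~` are `ℂ` (Def 4.1 (i): `log_k : k~ ⥲ k` is an isomorphism of
topological groups, inverse to the exponential), the shell-arrow `k~ ↠ k^×` is `Complex.exp`, `k^× = k ∖ {0}`, and the
space-link arrow is the inclusion `k^× ⊆ k`. -/

namespace ComplexLogShell

/-- Def 4.1 (i) "`k~ ↠ k^× := k ∖ {0}`": in the model the shell-arrow `exp` has image EXACTLY `k^× = k ∖ {0}` (it is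
onto `k^×`). [cite: MochizukiAbsTopIII2015, Def 5.4 (v) p. 127] -/
theorem range_shellArrow : Set.range Complex.exp = {0}ᶜ := Complex.range_exp

/-- the shell-arrow is a natural map of topological groups `(k~, +) → (k^×, ·)` — continuous, a homomorphism from
addition to multiplication, with values in `k^×` — and is holomorphic (a morphism of `TH⊞`, Def 4.1 (i)).
[cite: MochizukiAbsTopIII2015, Def 5.4 (v) p. 127] -/
theorem shellArrow_continuous_hom_holomorphic :
    Continuous Complex.exp ∧ (∀ x y : ℂ, exp (x + y) = exp x * exp y) ∧ (∀ z : ℂ, exp z ≠ 0) ∧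
      Differentiable ℂ Complex.exp :=
  ⟨continuous_exp, exp_add, exp_ne_zero, differentiable_exp⟩

/-- Def 4.1 (iv), "the compact subset `𝒪^×_k ⊆ k^×` that lies in the natural quotient `k~ ↠ k^×` — which we shall
refer to as the pre-log-shell": in the model the image of `ℐ*` under the shell-arrow is the typed unit group
`𝒪^×_{k~} = ComplexLogShell.units` (the unit circle), a compact subset of `k^×`.
[cite: MochizukiAbsTopIII2015, Def 5.4 (v) p. 128] -/
theorem exp_image_preLogShell_eq_units :
    exp '' preLogShell = units ∧ IsCompact units ∧ units ⊆ ({0}ᶜ : Set ℂ) := by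
  rw [units_eq_sphere, exp_image_preLogShell]
  refine ⟨rfl, isCompact_sphere 0 1, fun z hz => ?_⟩
  rw [mem_sphere, dist_zero_right] at hz
  rw [mem_compl_iff, mem_singleton_iff]
  intro h
  rw [h, norm_zero] at hz
  exact zero_ne_one hz

/-! ## §3 "`Γ⃗^log_arc` is a diagram in `TH`, `Γ⃗^⋉_arc` a diagram in `TH` or in `TH⊞`" -/

/-- the two arrows of `Γ⃗^⋉_arc` — the post-log arrow `k~ →(id) k~` and the shell-arrow `k~ ↠ k^×` — are continuous
group homomorphisms ("relative to the additive topological group structure of the field `k~`"; the shell-arrow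
to the multiplicative group `k^×`) and holomorphic: `Γ⃗^⋉_arc` is a diagram in `TH⊞` (connected Aut-holomorphic
groups and their homomorphisms, Def 4.1 (i)) as well as in `TH`. [cite: MochizukiAbsTopIII2015, Def 5.4 (v) p. 127] -/
theorem leftGraph_arrows_hom_holomorphic :
    (Continuous (id : ℂ → ℂ) ∧ (∀ x y : ℂ, id (x + y) = id x + id y) ∧ Differentiable ℂ (id : ℂ → ℂ)) ∧
      (Continuous Complex.exp ∧ (∀ x y : ℂ, exp (x + y) = exp x * exp y) ∧ Differentiable ℂ Complex.exp) :=
  ⟨⟨continuous_id, fun _ _ => rfl, differentiable_id⟩, ⟨continuous_exp, exp_add, differentiable_exp⟩⟩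

/-- the removed space-link arrow `k^× ↪ k` is still holomorphic on the open subset `k^× = k ∖ {0}` of `k` (so the
ENTIRE diagram `Γ⃗^log_arc` is a diagram in `TH`) … [cite: MochizukiAbsTopIII2015, Def 5.4 (v) p. 127] -/
theorem spaceLinkArrow_holomorphicOn :
    IsOpen ({0}ᶜ : Set ℂ) ∧ DifferentiableOn ℂ (fun z : ℂ => z) ({0}ᶜ : Set ℂ) ∧
      ContinuousOn (fun z : ℂ => z) ({0}ᶜ : Set ℂ) :=
  ⟨isOpen_compl_singleton, differentiableOn_id, continuousOn_id⟩

/-- … but it is NOT a homomorphism from the multiplicative group `k^×` to the additive group of `k`: the inclusion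
does not carry products of units to sums (`1·1 ≠ 1 + 1`), so `Γ⃗^log_arc` is a `TH`-diagram and not a
`TH⊞`-diagram — only `Γ⃗^⋉_arc` is. [cite: MochizukiAbsTopIII2015, Def 5.4 (v) p. 127] -/
theorem spaceLinkArrow_not_hom : ¬ ∀ u v : ℂ, u ≠ 0 → v ≠ 0 → u * v = u + v := by
  intro h
  have h1 := h 1 1 one_ne_zero one_ne_zero
  norm_num at h1

/-! ## §4 "`ℐ*` … the line segment [closure of a connected pre-compact open subset of a one-parameter subgroup]" -/

/-- the one-parameter subgroup `ℝ·i` of `k~ ≅ ℂ` carrying `ℐ*`: `t ↦ t·i` is a continuous, injective, additive map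
`ℝ → k~`. [cite: MochizukiAbsTopIII2015, Def 5.4 (v) p. 128] -/
theorem oneParameterSubgroup_I :
    Continuous (fun t : ℝ => (t : ℂ) * I) ∧ Function.Injective (fun t : ℝ => (t : ℂ) * I) ∧
      ∀ s t : ℝ, (((s + t : ℝ) : ℂ) * I) = (s : ℂ) * I + (t : ℂ) * I := by
  refine ⟨by fun_prop, fun s t h => ?_, fun s t => by push_cast; ring⟩
  have h' : (s : ℂ) * I = (t : ℂ) * I := h
  exact_mod_cast mul_right_cancel₀ I_ne_zero h'

/-- `ℐ*` is compact. [cite: MochizukiAbsTopIII2015, Def 5.4 (v) p. 128] -/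
theorem isCompact_preLogShell : IsCompact preLogShell := by
  unfold preLogShell coreSegment
  exact isCompact_Icc.image (by fun_prop)

/-- the log-shell `ℐ` is compact. [cite: MochizukiAbsTopIII2015, Def 5.4 (v) p. 127] -/
theorem isCompact_logShell : IsCompact logShell := by
  rw [logShell_eq_closedBall]
  exact isCompact_closedBall 0 π

/-- **Def 5.4 (v)**, "`ℐ*` … [i.e., more precisely: closure of a connected pre-compact open subset of a one-parameter
subgroup]": the typed `ℐ* = {t·i : t ∈ [-π, π]}` IS the closure in `k~` of the open segment `{t·i : -π < t < π}` of
the one-parameter subgroup `ℝ·i`. [cite: MochizukiAbsTopIII2015, Def 5.4 (v) p. 128] -/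
theorem preLogShell_eq_closure_image_Ioo :
    preLogShell = closure ((fun t : ℝ => (t : ℂ) * I) '' Ioo (-π) π) := by
  have hπ : (-π : ℝ) < π := by linarith [Real.pi_pos]
  have hcont : Continuous fun t : ℝ => (t : ℂ) * I := by fun_prop
  apply Subset.antisymm
  · show (fun t : ℝ => (t : ℂ) * I) '' Icc (-π) π ⊆ _
    rw [← closure_Ioo hπ.ne]
    exact image_closure_subset_closure_image hcont
  · exact closure_minimal (image_mono Ioo_subset_Icc_self) isCompact_preLogShell.isClosed

/-- … and that open segment is the image, under the one-parameter subgroup `t ↦ t·i`, of an OPEN, CONNECTED subset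
`(-π, π)` of `ℝ` with COMPACT closure; it is open in the subgroup `ℝ·i` for the relative topology (cut out of
`ℝ·i` by the open set `{-π < im < π}` of `k~`), connected, and pre-compact in `k~` (its closure `ℐ*` is compact).
[cite: MochizukiAbsTopIII2015, Def 5.4 (v) p. 128] -/
theorem openSegment_isOpen_isConnected_precompact :
    IsOpen (Ioo (-π) π) ∧ IsConnected (Ioo (-π) π) ∧ IsCompact (closure (Ioo (-π) π)) ∧
      (∃ U : Set ℂ, IsOpen U ∧
        U ∩ Set.range (fun t : ℝ => (t : ℂ) * I) = (fun t : ℝ => (t : ℂ) * I) '' Ioo (-π) π) ∧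
      IsConnected ((fun t : ℝ => (t : ℂ) * I) '' Ioo (-π) π) ∧
      IsCompact (closure ((fun t : ℝ => (t : ℂ) * I) '' Ioo (-π) π)) := by
  have hπ : (-π : ℝ) < π := by linarith [Real.pi_pos]
  have hcont : Continuous fun t : ℝ => (t : ℂ) * I := by fun_prop
  refine ⟨isOpen_Ioo, isConnected_Ioo hπ, ?_, ?_, (isConnected_Ioo hπ).image _ hcont.continuousOn, ?_⟩
  · rw [closure_Ioo hπ.ne]
    exact isCompact_Icc
  · refine ⟨Complex.im ⁻¹' Ioo (-π) π, isOpen_Ioo.preimage continuous_im, ?_⟩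
    ext z
    simp only [mem_inter_iff, mem_preimage, mem_Ioo, mem_range, mem_image]
    constructor
    · rintro ⟨⟨h1, h2⟩, t, rfl⟩
      exact ⟨t, ⟨by simpa using h1, by simpa using h2⟩, rfl⟩
    · rintro ⟨t, ⟨h1, h2⟩, rfl⟩
      exact ⟨⟨by simpa using h1, by simpa using h2⟩, t, rfl⟩
  · rw [← preLogShell_eq_closure_image_Ioo]
    exact isCompact_preLogShell

/-- **Def 5.4 (v), uniqueness of `ℐ*` in print's own topological formulation**: a subset `S ⊆ k~` which is the
closure of the image, under a one-parameter subgroup `t ↦ t·w` of `k~ ≅ ℂ`, of a connected open subset `U ⊆ ℝ`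
with compact closure ("closure of a connected pre-compact open subset of a one-parameter subgroup"), which is
"preserved by multiplication by `±1`" and "whose endpoints" `(inf U)·w`, `(sup U)·w` "differ by a generator"
`±2πi` "of `Ker(k~ ↠ k^×)`", IS the typed `ℐ*`. (Reduces, via `eq_Ioo_of_isOpen_of_isConnected` of
`MonoAnalyticArchSegProofs.lean`, to the parametrised uniqueness `eq_preLogShell_of_neg_mem_of_endpoints` of
`LogShellsArchProofs.lean`.) [cite: MochizukiAbsTopIII2015, Def 5.4 (v) p. 128] -/
theorem eq_preLogShell_of_closure_image {w : ℂ} {U : Set ℝ} (hU : IsOpen U) (hc : IsConnected U)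
    (hK : IsCompact (closure U)) {S : Set ℂ} (hS : S = closure ((fun t : ℝ => (t : ℂ) * w) '' U))
    (hneg : ∀ z ∈ S, -z ∈ S)
    (hends : ((sSup U : ℝ) : ℂ) * w - ((sInf U : ℝ) : ℂ) * w = 2 * π * I ∨
      ((sSup U : ℝ) : ℂ) * w - ((sInf U : ℝ) : ℂ) * w = -(2 * π * I)) :
    S = preLogShell := by
  obtain ⟨a, b, hab, rfl⟩ := eq_Ioo_of_isOpen_of_isConnected hU hc hK
  rw [csSup_Ioo hab, csInf_Ioo hab] at hends
  have hcont : Continuous fun t : ℝ => (t : ℂ) * w := by fun_prop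
  have hS' : S = (fun t : ℝ => (t : ℂ) * w) '' Icc a b := by
    rw [hS]
    apply Subset.antisymm
    · exact closure_minimal (image_mono Ioo_subset_Icc_self) (isCompact_Icc.image hcont).isClosed
    · rw [← closure_Ioo hab.ne]
      exact image_closure_subset_closure_image hcont
  exact eq_preLogShell_of_neg_mem_of_endpoints hab.le hS' hneg hends

/-! ## §5 "the finite order automorphisms of the Aut-holomorphic group `k~`" -/

/-- The Aut-holomorphic endomorphisms of the additive group `k~ ≅ ℂ` are the homotheties: every holomorphic
(`ℂ`-differentiable) additive self-map `f` of `ℂ` is `z ↦ f(1)·z` — a continuous additive map is `ℝ`-linear, so it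
is its own `ℝ`-Fréchet derivative, which by uniqueness is the `ℂ`-linear derivative at `0`.
[cite: MochizukiAbsTopIII2015, Def 5.4 (v) p. 128] -/
theorem addMonoidHom_eq_mul_of_differentiable (f : ℂ →+ ℂ) (hf : Differentiable ℂ f) (z : ℂ) :
    f z = f 1 * z := by
  have h1 : HasFDerivAt (⇑f) ((fderiv ℂ (⇑f) 0).restrictScalars ℝ) 0 :=
    (hf 0).hasFDerivAt.restrictScalars ℝ
  have h2 : HasFDerivAt (⇑f) (f.toRealLinearMap hf.continuous) 0 := by
    have h := (f.toRealLinearMap hf.continuous).hasFDerivAt (x := (0 : ℂ))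
    rwa [AddMonoidHom.coe_toRealLinearMap] at h
  have h3 : (fderiv ℂ (⇑f) 0).restrictScalars ℝ = f.toRealLinearMap hf.continuous := h1.unique h2
  have h4 : ∀ x : ℂ, fderiv ℂ (⇑f) 0 x = f x := fun x => by
    have h := congrArg (fun g : ℂ →L[ℝ] ℂ => g x) h3
    simpa using h
  calc f z = fderiv ℂ (⇑f) 0 z := (h4 z).symm
    _ = fderiv ℂ (⇑f) 0 (z • (1 : ℂ)) := by rw [smul_eq_mul, mul_one]
    _ = z • fderiv ℂ (⇑f) 0 1 := ContinuousLinearMap.map_smul _ _ _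
    _ = f 1 * z := by rw [h4 1, smul_eq_mul, mul_comm]

/-- hence the iterates of such an `f` are `z ↦ f(1)^m·z` … [cite: MochizukiAbsTopIII2015, Def 5.4 (v) p. 128] -/
theorem iterate_apply_eq_pow_mul (f : ℂ →+ ℂ) (hf : Differentiable ℂ f) (m : ℕ) (z : ℂ) :
    (⇑f)^[m] z = (f 1) ^ m * z := by
  induction m generalizing z with
  | zero => simp
  | succ m ih =>
    rw [Function.iterate_succ_apply', ih, addMonoidHom_eq_mul_of_differentiable f hf, pow_succ]
    ring

/-- … so a FINITE ORDER holomorphic additive self-map of `k~` (`f^[n] = id`, `0 < n`) is multiplication by the root of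
unity `f(1)`, `f(1)^n = 1`. [cite: MochizukiAbsTopIII2015, Def 5.4 (v) p. 128] -/
theorem pow_apply_one_eq_one_of_iterate_eq_id (f : ℂ →+ ℂ) (hf : Differentiable ℂ f) {n : ℕ}
    (hn : (⇑f)^[n] = id) : (f 1) ^ n = 1 := by
  have h := iterate_apply_eq_pow_mul f hf n 1
  rw [hn, mul_one] at h
  exact h.symm

/-- a self-map some positive iterate of which is the identity is bijective: the finite-order holomorphic additive
self-maps of `k~` are exactly its finite-order AUTOMORPHISMS in `TH⊞`. [cite: MochizukiAbsTopIII2015, Def 5.4 (v) p. 128] -/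
theorem bijective_of_iterate_eq_id {α : Type*} {f : α → α} {n : ℕ} (hn : 0 < n) (h : f^[n] = id) :
    Function.Bijective f := by
  obtain ⟨m, rfl⟩ := Nat.exists_eq_succ_of_ne_zero hn.ne'
  refine ⟨Function.LeftInverse.injective (g := f^[m]) fun x => ?_,
    Function.RightInverse.surjective (g := f^[m]) fun x => ?_⟩
  · have hx := congrFun h x
    rwa [Function.iterate_succ_apply] at hx
  · have hx := congrFun h x
    rwa [Function.iterate_succ_apply'] at hx

/-- **Def 5.4 (v)**: "`ℐ` may be constructed as the closure of the union of the images of `ℐ*` via the finite order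
automorphisms of the Aut-holomorphic group `k~`; in particular, the formation of `ℐ` from `ℐ*` depends only on the
structure of `k~` as an object of `TH⊞`" — in the model, with the union indexed by ALL finite-order holomorphic
additive self-maps of `k~ ≅ ℂ` (data of the topological group with its holomorphic structure only), the closure is
the typed log-shell `ℐ`. [cite: MochizukiAbsTopIII2015, Def 5.4 (v) p. 128] -/
theorem closure_iUnion_finiteOrderAut_image_preLogShell :
    closure (⋃ (f : ℂ →+ ℂ) (_ : Differentiable ℂ f) (n : ℕ) (_ : 0 < n) (_ : (⇑f)^[n] = id),
      ⇑f '' preLogShell) = logShell := by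
  rw [← closure_iUnion_rootOfUnity_smul_preLogShell]
  congr 1
  apply Subset.antisymm
  · intro z hz
    obtain ⟨f, hz⟩ := mem_iUnion.1 hz
    obtain ⟨hf, hz⟩ := mem_iUnion.1 hz
    obtain ⟨n, hz⟩ := mem_iUnion.1 hz
    obtain ⟨hn, hz⟩ := mem_iUnion.1 hz
    obtain ⟨hit, hz⟩ := mem_iUnion.1 hz
    obtain ⟨y, hy, rfl⟩ := hz
    refine mem_iUnion.2 ⟨n, mem_iUnion.2 ⟨hn, mem_iUnion.2 ⟨f 1, mem_iUnion.2
      ⟨pow_apply_one_eq_one_of_iterate_eq_id f hf hit, ?_⟩⟩⟩⟩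
    exact Set.mem_smul_set.2 ⟨y, hy, (addMonoidHom_eq_mul_of_differentiable f hf y).symm⟩
  · intro z hz
    obtain ⟨n, hz⟩ := mem_iUnion.1 hz
    obtain ⟨hn, hz⟩ := mem_iUnion.1 hz
    obtain ⟨ζ, hz⟩ := mem_iUnion.1 hz
    obtain ⟨hζ, hz⟩ := mem_iUnion.1 hz
    obtain ⟨y, hy, rfl⟩ := Set.mem_smul_set.1 hz
    have hdiff : Differentiable ℂ (⇑(AddMonoidHom.mulLeft ζ : ℂ →+ ℂ)) := by
      rw [AddMonoidHom.coe_mulLeft]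
      exact differentiable_id.const_mul ζ
    have hiter : (⇑(AddMonoidHom.mulLeft ζ : ℂ →+ ℂ))^[n] = id := by
      rw [AddMonoidHom.coe_mulLeft, mul_left_iterate, hζ]
      funext x
      exact one_mul x
    exact mem_iUnion.2 ⟨AddMonoidHom.mulLeft ζ, mem_iUnion.2 ⟨hdiff, mem_iUnion.2 ⟨n, mem_iUnion.2 ⟨hn,
      mem_iUnion.2 ⟨hiter, ⟨y, hy, rfl⟩⟩⟩⟩⟩⟩

end ComplexLogShell

end Literature.AnabelianGeometry.AbsoluteAnabelian

end
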